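import Literature.NumberTheory.Sieve.LargestPrimeFactorCubicTilted
import Literature.NumberTheory.Sieve.LargestPrimeFactorCubicExpIntegral
import Literature.NumberTheory.Sieve.LargestPrimeFactorCubicNumericsN
import HarnessLib

/-!
# Certification tools for the numerics of Irving's Lemma 4.2 (§5)

Twelfth proved layer under the named fact `Irving2015_largestPrimeFactor_cubic`
(`LargestPrimeFactorCubic.lean`; A. J. Irving, arXiv:1412.0024 = Acta Arith. 171 (2015)).
Irving, §5: "we may use Lemma 4.2 to handle the smaller `h` … The optimal values of the `α_k`
were determined numerically … `∑_{h=133}^{189} min(h,[1/δ]) 2^h T(h,δ) ≤ X(3.6 × 10⁻⁸ + o(1))`."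
The files `…NumericsL42A/B/C.lean` certify this display term by term (with `K = [h/3] + 12` and
clipped-linear tilts `α_k = A_h − B_h·min(k, K−1)`, fitted offline); this file supplies the small
generic lemmas they instantiate, all PROVED:

* `Irving2015.integral_exp_div_nonneg`, `Irving2015.integral_cert` (rational upper bound for
  `∫_a^b e^{αs}ds/s` = `integral_exp_div_le_taylor` + `log_le_of_le_taylor`),
* `Irving2015.exp_neg_le_cert` (`e^{-as} ≤ (1/∑_{i≤M}(as/16)^i/i!)^{16}`),
* `Irving2015.term_cert`, `Irving2015.last_cert` (one tilted / the untilted term from its pieces),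
* `Irving2015.alpha_pos`, `Irving2015.rho_cond` (side conditions of `irving_lemma_4_2`).

## References

* A. J. Irving, *The largest prime factor of `X³ + 2`*, arXiv:1412.0024; Acta Arith. 171 (2015)
  67–80, §§4–5. [`Irving2014LargestPrimeFactorCubic`]
-/

noncomputable section

open Finset

namespace Literature.NumberTheory.Sieve

namespace Irving2015

/-! ## Certification tools for the numerics of Lemma 4.2 (§5) -/

section L42Tools

open MeasureTheory intervalIntegral

/-- `0 ≤ ∫_a^b e^{αs} ds/s` for `0 < a ≤ b`. [folklore] -/
theorem integral_exp_div_nonneg {α a b : ℝ} (ha : 0 < a) (hab : a ≤ b) :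
    0 ≤ ∫ s in a..b, Real.exp (α * s) / s :=
  intervalIntegral.integral_nonneg hab fun _ hs => div_nonneg (Real.exp_pos _).le (ha.le.trans hs.1)

/-- Certified upper bound for `∫_a^b e^{αs} ds/s` from rational data. [folklore] -/
theorem integral_cert {α a b u r : ℝ} {n : ℕ} (N : ℕ) (ha : 0 < a) (hab : a ≤ b) (hα : 0 ≤ α)
    (hn1 : 1 ≤ n) (hn : α * b / (n + 1) ≤ 1 / 2) (hu : 0 ≤ u)
    (hρ : b / a ≤ ∑ i ∈ range N, u ^ i / i.factorial)
    (hr : u + (∑ j ∈ range (n - 1), α ^ (j + 1) * (b ^ (j + 1) - a ^ (j + 1)) /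
        ((j + 1) * (j + 1).factorial) + 2 * α ^ n * (b ^ n - a ^ n) / (n * n.factorial)) ≤ r) :
    ∫ s in a..b, Real.exp (α * s) / s ≤ r := by
  have h1 := integral_exp_div_le_taylor ha hab hα hn1 hn
  have h2 : Real.log (b / a) ≤ u := log_le_of_le_taylor (div_pos (ha.trans_le hab) ha) hu N hρ
  linarith only [h1, h2, hr]

/-- Certified upper bound for `e^{-as}` from rational data: `e^{-x} = (e^{-x/16})^{16} ≤ S⁻¹⁶`,
`S = ∑_{i<M} (x/16)^i/i! ≤ e^{x/16}`. [folklore] -/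
theorem exp_neg_le_cert {a s e : ℝ} (M : ℕ) (ha : 0 ≤ a) (hs : 0 ≤ s)
    (h : (1 / ∑ i ∈ range (M + 1), (a * s / 16) ^ i / i.factorial) ^ 16 ≤ e) :
    Real.exp (-a * s) ≤ e := by
  have hx : 0 ≤ a * s / 16 := by positivity
  have hS : ∑ i ∈ range (M + 1), (a * s / 16) ^ i / i.factorial ≤ Real.exp (a * s / 16) :=
    Real.sum_le_exp_of_nonneg hx (M + 1)
  have hS0 : 0 < ∑ i ∈ range (M + 1), (a * s / 16) ^ i / i.factorial := by
    rw [Finset.sum_range_succ']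
    simp only [pow_zero, Nat.factorial_zero, Nat.cast_one, div_one]
    have : 0 ≤ ∑ i ∈ range M, (a * s / 16) ^ (i + 1) / ((i + 1).factorial : ℝ) :=
      sum_nonneg fun i _ => by positivity
    linarith
  have h1 : Real.exp (-(a * s / 16)) ≤ 1 / ∑ i ∈ range (M + 1), (a * s / 16) ^ i / i.factorial := by
    rw [Real.exp_neg, one_div]; exact inv_anti₀ hS0 hS
  have h2 : Real.exp (-a * s) = Real.exp (-(a * s / 16)) ^ 16 := by
    rw [← Real.exp_nat_mul]; congr 1; push_cast; ring
  rw [h2]; exact (pow_le_pow_left₀ (Real.exp_pos _).le h1 16).trans h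

/-- One tilted term from its certified pieces. [folklore] -/
theorem term_cert {y I r e t : ℝ} {k : ℕ} (hI0 : 0 ≤ I) (hI : I ≤ r) (hE : Real.exp y ≤ e)
    (ht : e * r ^ k / k.factorial ≤ t) : Real.exp y * I ^ k / k.factorial ≤ t := by
  have he0 : 0 ≤ e := (Real.exp_pos _).le.trans hE
  calc Real.exp y * I ^ k / k.factorial ≤ e * r ^ k / k.factorial := by
        refine div_le_div_of_nonneg_right ?_ (by positivity)
        exact mul_le_mul hE (pow_le_pow_left₀ hI0 hI k) (by positivity) he0
    _ ≤ t := ht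

/-- The last (untilted) term from its certified pieces. [folklore] -/
theorem last_cert {ρ u t : ℝ} {K : ℕ} (N : ℕ) (hρ1 : 1 ≤ ρ) (hu : 0 ≤ u)
    (hρ : ρ ≤ ∑ i ∈ range N, u ^ i / i.factorial) (ht : u ^ K / K.factorial ≤ t) :
    Real.log ρ ^ K / K.factorial ≤ t := by
  have hlog : Real.log ρ ≤ u := log_le_of_le_taylor (by linarith) hu N hρ
  have h0 : 0 ≤ Real.log ρ := Real.log_nonneg hρ1
  exact (div_le_div_of_nonneg_right (pow_le_pow_left₀ h0 hlog K) (by positivity)).trans ht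

/-- Positivity of the clipped linear tilt `α_k = A − B·min(k, K_c)`. [folklore] -/
theorem alpha_pos {A B : ℝ} {Kc : ℕ} (hB : 0 ≤ B) (h : B * Kc < A) (k : ℕ) :
    0 < A - B * ((min k Kc : ℕ) : ℝ) := by
  have h1 : ((min k Kc : ℕ) : ℝ) ≤ Kc := by exact_mod_cast min_le_right k Kc
  have h2 := mul_le_mul_of_nonneg_left h1 hB
  linarith

/-- The sign condition of Lemma 4.2 at `δ = 1/321`: `(h−k+1)/321 ≤ 3 − (k−1)/321` for
`1 ≤ k ≤ h ≤ 963`. [folklore] -/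
theorem rho_cond {h k : ℕ} (hk : 1 ≤ k) (hkh : k ≤ h) (hh : h ≤ 963) :
    ((h - k + 1 : ℕ) : ℝ) * ((1 : ℝ) / 321) ≤ 3 - ((k - 1 : ℕ) : ℝ) * ((1 : ℝ) / 321) := by
  have e1 : ((h - k + 1 : ℕ) : ℝ) + ((k - 1 : ℕ) : ℝ) = h := by
    have : (h - k + 1) + (k - 1) = h := by omega
    exact_mod_cast this
  have h963 : (h : ℝ) ≤ 963 := by exact_mod_cast hh
  linarith

end L42Tools

end Irving2015

end Literature.NumberTheory.Sieve
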